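import Literature.NumberTheory.Automorphic.GodementJacquetLocalRationality
import Literature.NumberTheory.Automorphic.GodementJacquetLocalLFactor
import Literature.NumberTheory.Automorphic.GodementJacquetLocalProofs
import Literature.NumberTheory.Automorphic.GodementJacquetSphericalZeta
import Literature.NumberTheory.Automorphic.CompactOpenAveraging
import Literature.NumberTheory.GaloisRepresentations.LocalFieldProofs
import HarnessLib

/-!
# Godement–Jacquet (1972), Thm. 3.3 (2): existence and uniqueness of the local `L`-factor —
the discharge of `GodementJacquet1972_local_existsUnique_hasGJLFactor`

Topic `NumberTheory/Automorphic`; theorems only. We prove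
`GodementJacquet1972_local_existsUnique_hasGJLFactor_holds` by verifying the common-denominator
criterion `GodementJacquet1972_local_existsUnique_hasGJLFactor_of_denominators`
(`GodementJacquetLocalLFactor`): for an irreducible admissible `π` on `V` and a Haar measure there
is ONE polynomial `P₀'` such that every normalised zeta integral `Z(Φ, s + (n-1)/2, ⟨π(·) v, φ⟩)`
equals `R(q^{-s}) / P₀'(q^{-s})` on a right half-plane with `R ∈ ℂ[T, T⁻¹]`.

Proof (elementary, replacing the Kirillov-model / asymptotic-expansion argument of LNM 260, §3):
fix a non-zero `v₀` of level `K_m` (`m ≥ 1`); by irreducibility of `π` and of its contragredient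
(`Representation.isIrreducible_contragredient_holds`) every coefficient is a finite combination of
two-sided translates of `⟨π(·) v₀, φ⟩` with `φ` smooth, and translating `Φ` costs integer powers of
`q^{-s}` (`gjLocalZeta_comp_conj_det`); a central scaling makes `Φ` supported in `M_n(𝒪)`
(changing `φ` by a central translate, still `K_m`-invariant when `φ` is); the finite bi-`K_m`-average
of `Φ` over a transversal of `K_m / K_{M'}` (`CompactOpenAveraging`) is a class function at level
`K_m` with the same zeta integral against `⟨π(·) v₀, φ⟩` up to the factor `#R²`
(`exists_classFun_gjLocalZeta_eq`); and the class functions at level `K_m` have ONE common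
denominator by `exists_poly_isLaurentTimes_classFun` (`GodementJacquetLocalRationality`: Hecke
shift, counting of congruence classes, Cayley–Hamilton, induction on pins). The half-plane of
convergence is `GodementJacquet1972_local_convergence_holds`; right invariance of the Haar measure
is `isMulRightInvariant_of_isHaarMeasure_gl`.

## References

* R. Godement, H. Jacquet, *Zeta functions of simple algebras*, LNM 260 (1972), Thm. 3.3 (2)
  [GodementJacquet1972].
* H. Jacquet, *Principal `L`-functions of the linear group*, Proc. Sympos. Pure Math. 33 (1979),
  Part 2, Prop. (1.2)(2) [JacquetCorvallis1979].
-/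

set_option autoImplicit false

noncomputable section

open scoped MatrixGroups Matrix NNReal
open Matrix ValuativeRel Polynomial MeasureTheory
open Literature.NumberTheory.GaloisRepresentations.IsNonarchimedeanLocalField

namespace Literature.NumberTheory.Automorphic

/-! ### Packaging: from `IsLaurentTimes` to `R(q^{-s}) / P(q^{-s})` on a half-plane -/

section Packaging

/-- **Shifting and packaging.** If `Z · P(q^{-s})` is a Laurent polynomial in `q^{-s}` for
`re s > s₀`, then `s ↦ Z(s + σ)` equals `R(q^{-s}) · P'(q^{-s})⁻¹` on a right half-plane, with
`R ∈ ℂ[T, T⁻¹]` and `P' = P(q^{-σ} T)` (independent of `Z`). [folklore] -/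
theorem exists_isLaurent_eqOn_of_isLaurentTimes {q : ℕ} (hq : 1 < q) {s₀ : ℝ} {P : ℂ[X]} (hP : P ≠ 0)
    {Z : ℂ → ℂ} (h : IsLaurentTimes q s₀ P Z) (σ : ℂ) :
    ∃ R : RatFunc ℂ, IsLaurent R ∧ EqOnRightHalfPlane q (fun s => Z (s + σ))
      (R * rsLRat (P.comp (Polynomial.C ((q : ℂ) ^ (-σ)) * X))) := by
  obtain ⟨p, k, hp⟩ := h
  have hq0 : (q : ℂ) ≠ 0 := Nat.cast_ne_zero.mpr (by omega)
  set α : ℂ := (q : ℂ) ^ (-σ) with hα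
  have hα0 : α ≠ 0 := Complex.cpow_ne_zero_iff.2 (Or.inl hq0)
  set P' : ℂ[X] := P.comp (Polynomial.C α * X) with hP'
  set p' : ℂ[X] := p.comp (Polynomial.C α * X) with hp'
  have hlin : Polynomial.C α * X ≠ Polynomial.C ((Polynomial.C α * X).coeff 0) := by
    intro h
    have := congrArg (fun f : ℂ[X] => f.coeff 1) h
    simp [Polynomial.coeff_C] at this
    exact hα0 this
  have hP'0 : P' ≠ 0 := by
    intro h0
    rw [hP', Polynomial.comp_eq_zero_iff] at h0
    rcases h0 with h0 | ⟨-, h0⟩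
    · exact hP h0
    · exact hlin h0
  -- the shifted identity
  have hxs : ∀ s : ℂ, (q : ℂ) ^ (-(s + σ)) = α * (q : ℂ) ^ (-s) := by
    intro s
    rw [neg_add, Complex.cpow_add _ _ hq0, mul_comm]
  have hshift : ∀ s : ℂ, s₀ - σ.re < s.re →
      Z (s + σ) * P'.eval ((q : ℂ) ^ (-s)) = p'.eval ((q : ℂ) ^ (-s)) / (α * (q : ℂ) ^ (-s)) ^ k := by
    intro s hs
    have h1 := hp (s + σ) (by rw [Complex.add_re]; linarith)
    rw [hxs s] at h1
    rw [hP', hp', Polynomial.eval_comp, Polynomial.eval_comp, Polynomial.eval_mul, Polynomial.eval_C,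
      Polynomial.eval_X]
    exact h1
  refine ⟨algebraMap ℂ[X] (RatFunc ℂ) (Polynomial.C (α ^ k)⁻¹ * p') / RatFunc.X ^ k, ⟨_, k, rfl⟩, ?_⟩
  rw [eqOnRightHalfPlane_iff]
  have hev : ∀ᶠ s : ℂ in rightHalfPlanes, s₀ - σ.re < s.re :=
    eventually_rightHalfPlanes_iff.mpr ⟨s₀ - σ.re, fun s hs => hs⟩
  filter_upwards [hev, eventually_eval_qpow_ne_zero hq hP'0,
    eventually_evalAtQ_mul hq (algebraMap ℂ[X] (RatFunc ℂ) (Polynomial.C (α ^ k)⁻¹ * p') / RatFunc.X ^ k)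
      (rsLRat P'),
    eventually_evalAtQ_mul hq (algebraMap ℂ[X] (RatFunc ℂ) (Polynomial.C (α ^ k)⁻¹ * p')) (rsLRat (X ^ k))]
    with s hs hP's hmul hmul'
  have hx0 : (q : ℂ) ^ (-s) ≠ 0 := Complex.cpow_ne_zero_iff.2 (Or.inl hq0)
  have hXk : (X ^ k : ℂ[X]) ≠ 0 := pow_ne_zero _ Polynomial.X_ne_zero
  have e1 : algebraMap ℂ[X] (RatFunc ℂ) (Polynomial.C (α ^ k)⁻¹ * p') / RatFunc.X ^ k =
      algebraMap ℂ[X] (RatFunc ℂ) (Polynomial.C (α ^ k)⁻¹ * p') * rsLRat (X ^ k) := by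
    rw [rsLRat, map_pow, RatFunc.algebraMap_X, div_eq_mul_inv]
  rw [hmul, e1, hmul', evalAtQ_algebraMap]
  unfold evalAtQ
  rw [eval_rsLRat hXk, eval_rsLRat hP'0, Polynomial.eval_pow, Polynomial.eval_X, Polynomial.eval_mul,
    Polynomial.eval_C]
  have h2 := hshift s hs
  field_simp at h2 ⊢
  linear_combination h2

end Packaging

/-! ### Integer powers of `q^{-s}` from absolute values; general two-sided substitution -/

section Substitution

variable {F : Type*} [Field F] [ValuativeRel F] [TopologicalSpace F] [IsNonarchimedeanLocalField F]
  {n : ℕ}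

/-- `|y|^s` is an integer power of `q^{-s}` (`y ≠ 0`). [folklore] -/
theorem exists_int_cpow_normAbs_eq {y : F} (hy : y ≠ 0) :
    ∃ e : ℤ, ∀ s : ℂ, (((normAbs F y : ℝ≥0) : ℝ) : ℂ) ^ s = ((residueFieldCard F : ℂ) ^ (-s)) ^ e := by
  have hq : residueFieldCard F ≠ 0 := residueFieldCard_ne_zero F
  rw [DeltaCharBorel.normAbs_eq_zpow_log hy]
  set e : ℤ := (_root_.IsNonarchimedeanLocalField.valueGroupWithZeroIsoInt F (valuation F y)).log with he
  refine ⟨-e, fun s => ?_⟩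
  have h1 : ((((residueFieldCard F : ℝ≥0) ^ e : ℝ≥0) : ℝ) : ℂ) = (residueFieldCard F : ℂ) ^ e := by
    rw [NNReal.coe_zpow, Complex.ofReal_zpow, NNReal.coe_natCast, Complex.ofReal_natCast]
  rw [h1]
  obtain ⟨d, hd | hd⟩ := e.eq_nat_or_neg
  · rw [hd, zpow_natCast, _root_.zpow_neg, zpow_natCast]
    exact natCast_pow_cpow_eq_inv hq d s
  · rw [hd, _root_.zpow_neg, zpow_natCast, neg_neg, zpow_natCast]
    exact inv_natCast_pow_cpow _ d s

variable [MeasurableSpace (GL (Fin n) F)] [BorelSpace (GL (Fin n) F)]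
  {V : Type*} [AddCommGroup V] [Module ℂ V] (ρ : Representation ℂ (GL (Fin n) F) V)
  (μ : Measure (GL (Fin n) F))

/-- **General two-sided substitution.** For `κ, κ' ∈ GL_n(F)` and a bi-invariant measure,
`Z(Φ(κ⁻¹ · κ'⁻¹), s, ⟨ρ(·) w, ψ⟩) = |det κ|^s |det κ'|^s Z(Φ, s, ⟨ρ(·) ρ(κ') w, ψ ∘ ρ(κ)⟩)`.
[folklore] -/
theorem gjLocalZeta_comp_conj_det [μ.IsMulLeftInvariant] [μ.IsMulRightInvariant]
    (Φ : Matrix (Fin n) (Fin n) F → ℂ) (ψ : Module.Dual ℂ V) (w : V) (κ κ' : GL (Fin n) F) (s : ℂ) :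
    gjLocalZeta μ (fun X => Φ (((κ⁻¹ : GL (Fin n) F) : Matrix (Fin n) (Fin n) F) * X *
        ((κ'⁻¹ : GL (Fin n) F) : Matrix (Fin n) (Fin n) F))) (ρ.matrixCoeff ψ w) s =
      (((normAbs F ((Matrix.GeneralLinearGroup.det κ : Fˣ) : F) : ℝ≥0) : ℝ) : ℂ) ^ s *
        (((normAbs F ((Matrix.GeneralLinearGroup.det κ' : Fˣ) : F) : ℝ≥0) : ℝ) : ℂ) ^ s *
        gjLocalZeta μ Φ (ρ.matrixCoeff (ψ ∘ₗ ρ κ) (ρ κ' w)) s := by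
  unfold gjLocalZeta
  rw [← integral_const_mul]
  conv_lhs => rw [← integral_mul_left_eq_self _ κ, ← integral_mul_right_eq_self _ κ']
  refine integral_congr_ae (Filter.Eventually.of_forall fun x => ?_)
  have e : ((κ⁻¹ : GL (Fin n) F) : Matrix (Fin n) (Fin n) F) * ((κ * (x * κ') : GL (Fin n) F) :
      Matrix (Fin n) (Fin n) F) * ((κ'⁻¹ : GL (Fin n) F) : Matrix (Fin n) (Fin n) F) =
      (x : Matrix (Fin n) (Fin n) F) := by
    rw [← Units.val_mul, ← Units.val_mul, show κ⁻¹ * (κ * (x * κ')) * κ'⁻¹ = x by group]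
  simp only [gjLocalIntegrand, Representation.matrixCoeff_apply, e, map_mul ρ, Module.End.mul_apply,
    LinearMap.comp_apply]
  rw [cpow_normAbs_det_mul, cpow_normAbs_det_mul]
  ring

omit [BorelSpace (GL (Fin n) F)] in
/-- The zeta integral is linear in the coefficient (finite combinations, given convergence).
[folklore] -/
theorem gjLocalZeta_sum_right {ι : Type*} (T : Finset ι) (Φ : Matrix (Fin n) (Fin n) F → ℂ)
    (c : ι → ℂ) (f : ι → GL (Fin n) F → ℂ) (s : ℂ) (hint : ∀ i ∈ T, Integrable (gjLocalIntegrand Φ (f i) s) μ) :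
    gjLocalZeta μ Φ (fun x => ∑ i ∈ T, c i * f i x) s = ∑ i ∈ T, c i * gjLocalZeta μ Φ (f i) s := by
  unfold gjLocalZeta
  simp_rw [← integral_const_mul]
  rw [← integral_finsetSum _ fun i hi => (hint i hi).const_mul (c i)]
  refine integral_congr_ae (Filter.Eventually.of_forall fun x => ?_)
  simp only [gjLocalIntegrand, Finset.mul_sum, Finset.sum_mul]
  refine Finset.sum_congr rfl fun i _ => ?_
  ring

end Substitution

/-! ### The finite bi-`K_m`-average of a test function -/

section Averaging

variable {F : Type*} [Field F] [ValuativeRel F] [TopologicalSpace F] [IsNonarchimedeanLocalField F]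
  {n : ℕ} [MeasurableSpace (GL (Fin n) F)] [BorelSpace (GL (Fin n) F)]
  {V : Type*} [AddCommGroup V] [Module ℂ V] (ρ : Representation ℂ (GL (Fin n) F) V)
  (μ : Measure (GL (Fin n) F)) {ϖ : F} {m : ℕ}

/-- **Bi-`K_m`-averaging.** Let `Φ` be Schwartz–Bruhat supported in `M_n(𝒪)`, `w ∈ V^{K_m}` and `ψ`
a `K_m`-invariant linear form. Then there is a class function `f` at level `K_m` (constant on the
classes `K_m (Y + ϖ^N M_n(𝒪)) K_m`, vanishing off `M_n(𝒪)`) — the sum of `Φ(r⁻¹ X r')` over a finite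
transversal `R` of `K_m / K_{M'}`, `Φ` being bi-`K_{M'}`-invariant — with
`Z(f, s, ⟨ρ(·) w, ψ⟩) = #R² Z(Φ, s, ⟨ρ(·) w, ψ⟩)`. [folklore] -/
theorem exists_classFun_gjLocalZeta_eq [μ.IsMulLeftInvariant] [μ.IsMulRightInvariant]
    (hϖ : IsUniformizingElement ϖ) {Φ : Matrix (Fin n) (Fin n) F → ℂ}
    (hΦ : Φ ∈ SchwartzBruhat (Matrix (Fin n) (Fin n) F)) (hsupp : ∀ X, Φ X ≠ 0 → IsIntegralMatrix X)
    {w : V} (hw : w ∈ ρ.fixedPoints (congruenceGL n (valuation F ϖ ^ m))) {ψ : Module.Dual ℂ V}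
    (hψK : ∀ k ∈ congruenceGL n (valuation F ϖ ^ m), ∀ v, ψ (ρ k v) = ψ v) {s₀ : ℝ}
    (hint : ∀ Φ' ∈ SchwartzBruhat (Matrix (Fin n) (Fin n) F), ∀ s : ℂ, s₀ < s.re →
      Integrable (gjLocalIntegrand Φ' (ρ.matrixCoeff ψ w) s) μ) :
    ∃ (N : ℕ) (f : Matrix (Fin n) (Fin n) F → ℂ) (c : ℂ), c ≠ 0 ∧
      (∀ X Y, X ∈ gjClass ϖ m N Y → f X = f Y) ∧ (∀ X, f X ≠ 0 → IsIntegralMatrix X) ∧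
      ∀ s : ℂ, s₀ < s.re →
        gjLocalZeta μ f (ρ.matrixCoeff ψ w) s = c * gjLocalZeta μ Φ (ρ.matrixCoeff ψ w) s := by
  classical
  haveI : T2Space F := t2Space_of_isNonarchimedeanLocalField
  have hϖ0 := hϖ.ne_zero
  obtain ⟨M₁, -, hM₁⟩ := exists_forall_mul_congruenceGL_eq_of_mem_schwartzBruhat hϖ hΦ
  obtain ⟨N, hN⟩ := exists_forall_add_smul_eq_of_mem_schwartzBruhat hϖ hΦ
  set B : Subgroup (GL (Fin n) F) := congruenceGL n (valuation F ϖ ^ m) with hB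
  set T : Subgroup (GL (Fin n) F) := congruenceGL n (valuation F ϖ ^ M₁) with hT
  have hBint : B ≤ glInt n F := congruenceGL_le_glInt _
  obtain ⟨R, hR⟩ := exists_isLeftTransversal (B := B) (T := T) (isCompact_congruenceGL _)
    (isOpen_congruenceGL (valuation_pow_ne_zero' hϖ0 M₁))
  set f : Matrix (Fin n) (Fin n) F → ℂ := fun X => ∑ r ∈ R, ∑ r' ∈ R,
    Φ (((r⁻¹ : GL (Fin n) F) : Matrix (Fin n) (Fin n) F) * X * (r' : Matrix (Fin n) (Fin n) F)) with hf
  -- invariance properties of `f`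
  have hfadd : ∀ X E : Matrix (Fin n) (Fin n) F, ValBound (valuation F ϖ ^ N) E → f (X + E) = f X := by
    intro X E hE
    simp only [hf]
    refine Finset.sum_congr rfl fun r hr => Finset.sum_congr rfl fun r' hr' => ?_
    have hrint : r ∈ glInt n F := hBint (hR.mem_of_mem r hr)
    have hr'int : r' ∈ glInt n F := hBint (hR.mem_of_mem r' hr')
    set E' := ((r⁻¹ : GL (Fin n) F) : Matrix (Fin n) (Fin n) F) * E * (r' : Matrix (Fin n) (Fin n) F) with hE'
    have hE'b : ValBound (valuation F ϖ ^ N) E' :=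
      hE.integral_mul_mul (valBound_one_of_mem_glInt (Subgroup.inv_mem _ hrint)) (valBound_one_of_mem_glInt hr'int)
    have hY : IsIntegralMatrix ((ϖ ^ N)⁻¹ • E') := by
      intro i j
      rw [Matrix.smul_apply, smul_eq_mul, Valuation.mem_integer_iff, map_mul, map_inv₀, map_pow]
      have hv : valuation F ϖ ^ N ≠ 0 := valuation_pow_ne_zero' hϖ0 N
      calc (valuation F ϖ ^ N)⁻¹ * valuation F (E' i j) ≤ (valuation F ϖ ^ N)⁻¹ * valuation F ϖ ^ N :=
            mul_le_mul_right (hE'b i j) _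
        _ = 1 := inv_mul_cancel₀ hv
    have e : ((r⁻¹ : GL (Fin n) F) : Matrix (Fin n) (Fin n) F) * (X + E) * (r' : Matrix (Fin n) (Fin n) F) =
        ((r⁻¹ : GL (Fin n) F) : Matrix (Fin n) (Fin n) F) * X * (r' : Matrix (Fin n) (Fin n) F) +
          ϖ ^ N • ((ϖ ^ N)⁻¹ • E') := by
      rw [smul_smul, mul_inv_cancel₀ (pow_ne_zero _ hϖ0), one_smul, hE', Matrix.mul_add, Matrix.add_mul]
    rw [e, hN _ _ hY]
  have hfleft : ∀ X : Matrix (Fin n) (Fin n) F, ∀ k ∈ B, f ((k : Matrix (Fin n) (Fin n) F) * X) = f X := by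
    intro X k hk
    simp only [hf]
    set g : GL (Fin n) F → ℂ := fun y => ∑ r' ∈ R,
      Φ (((y⁻¹ : GL (Fin n) F) : Matrix (Fin n) (Fin n) F) * X * (r' : Matrix (Fin n) (Fin n) F)) with hg
    have hginv : ∀ x ∈ B, ∀ s ∈ B ⊓ T, g (x * s) = g x := by
      intro x _ s hs
      simp only [hg]
      refine Finset.sum_congr rfl fun r' _ => ?_
      rw [_root_.mul_inv_rev, Units.val_mul, Matrix.mul_assoc, Matrix.mul_assoc,
        (hM₁ s⁻¹ (Subgroup.inv_mem _ (Subgroup.mem_inf.mp hs).2) _).2, ← Matrix.mul_assoc]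
    have h1 : ∀ r ∈ R, ∑ r' ∈ R, Φ (((r⁻¹ : GL (Fin n) F) : Matrix (Fin n) (Fin n) F) *
        ((k : Matrix (Fin n) (Fin n) F) * X) * (r' : Matrix (Fin n) (Fin n) F)) = g (k⁻¹ * r) := by
      intro r _
      simp only [hg]
      refine Finset.sum_congr rfl fun r' _ => ?_
      rw [_root_.mul_inv_rev, inv_inv, Units.val_mul]
      simp only [Matrix.mul_assoc]
    rw [Finset.sum_congr rfl h1, hR.sum_mul_left g hginv (Subgroup.inv_mem _ hk)]
  have hfright : ∀ X : Matrix (Fin n) (Fin n) F, ∀ k ∈ B, f (X * (k : Matrix (Fin n) (Fin n) F)) = f X := by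
    intro X k hk
    simp only [hf]
    refine Finset.sum_congr rfl fun r _ => ?_
    set g : GL (Fin n) F → ℂ := fun y =>
      Φ (((r⁻¹ : GL (Fin n) F) : Matrix (Fin n) (Fin n) F) * X * (y : Matrix (Fin n) (Fin n) F)) with hg
    have hginv : ∀ x ∈ B, ∀ s ∈ B ⊓ T, g (x * s) = g x := by
      intro x _ s hs
      simp only [hg]
      rw [Units.val_mul, ← Matrix.mul_assoc, (hM₁ s (Subgroup.mem_inf.mp hs).2 _).1]
    have h1 : ∀ r' ∈ R, Φ (((r⁻¹ : GL (Fin n) F) : Matrix (Fin n) (Fin n) F) *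
        (X * (k : Matrix (Fin n) (Fin n) F)) * (r' : Matrix (Fin n) (Fin n) F)) = g (k * r') := by
      intro r' _
      simp only [hg]
      rw [Units.val_mul, Matrix.mul_assoc, Matrix.mul_assoc, Matrix.mul_assoc]
    rw [Finset.sum_congr rfl h1, hR.sum_mul_left g hginv hk]
  refine ⟨N, f, ((R.card : ℂ)) ^ 2, pow_ne_zero _ (Nat.cast_ne_zero.mpr (Finset.card_ne_zero.mpr hR.nonempty)),
    fun X Y hXY => ?_, fun X hX => ?_, fun s hs => ?_⟩
  · obtain ⟨k, hk, k', hk', hE⟩ := hXY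
    have e : X = (k : Matrix (Fin n) (Fin n) F) * (Y * (k' : Matrix (Fin n) (Fin n) F)) +
        (X - (k : Matrix (Fin n) (Fin n) F) * Y * (k' : Matrix (Fin n) (Fin n) F)) := by
      rw [Matrix.mul_assoc]; abel
    rw [e, hfadd _ _ hE, hfleft _ k hk, hfright _ k' hk']
  · obtain ⟨r, hr, hr0⟩ := Finset.exists_ne_zero_of_sum_ne_zero hX
    obtain ⟨r', hr', hr'0⟩ := Finset.exists_ne_zero_of_sum_ne_zero hr0
    have hint' := hsupp _ hr'0
    have hrint : r ∈ glInt n F := hBint (hR.mem_of_mem r hr)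
    have hr'int : r' ∈ glInt n F := hBint (hR.mem_of_mem r' hr')
    have hb := (ValBound.integral_mul_mul (fun i j => (Valuation.mem_integer_iff _ _).mp (hint' i j))
      (valBound_one_of_mem_glInt hrint) (valBound_one_of_mem_glInt (Subgroup.inv_mem _ hr'int)))
    have e : (r : Matrix (Fin n) (Fin n) F) * (((r⁻¹ : GL (Fin n) F) : Matrix (Fin n) (Fin n) F) * X *
        (r' : Matrix (Fin n) (Fin n) F)) * ((r'⁻¹ : GL (Fin n) F) : Matrix (Fin n) (Fin n) F) = X := by
      rw [← Matrix.mul_assoc, ← Matrix.mul_assoc, ← Units.val_mul, mul_inv_cancel, Units.val_one,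
        Matrix.one_mul, Matrix.mul_assoc, ← Units.val_mul, mul_inv_cancel, Units.val_one, Matrix.mul_one]
    rw [e] at hb
    exact fun i j => (Valuation.mem_integer_iff _ _).mpr (hb i j)
  · -- the zeta integral of `f`
    have hterm : ∀ r ∈ R, ∀ r' ∈ R, gjLocalZeta μ (fun X => Φ (((r⁻¹ : GL (Fin n) F) :
        Matrix (Fin n) (Fin n) F) * X * (r' : Matrix (Fin n) (Fin n) F))) (ρ.matrixCoeff ψ w) s =
        gjLocalZeta μ Φ (ρ.matrixCoeff ψ w) s := by
      intro r hr r' hr'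
      have h1 := gjLocalZeta_comp_conj ρ μ Φ ψ w (hBint (hR.mem_of_mem r hr))
        (Subgroup.inv_mem _ (hBint (hR.mem_of_mem r' hr'))) s
      rw [inv_inv] at h1
      rw [h1]
      congr 2
      · ext v; exact hψK r (hR.mem_of_mem r hr) v
      · exact (ρ.mem_fixedPoints _ w).1 hw _ (Subgroup.inv_mem _ (hR.mem_of_mem r' hr'))
    have hSB : ∀ r r' : GL (Fin n) F, (fun X => Φ (((r⁻¹ : GL (Fin n) F) : Matrix (Fin n) (Fin n) F) * X *
        (r' : Matrix (Fin n) (Fin n) F))) ∈ SchwartzBruhat (Matrix (Fin n) (Fin n) F) :=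
      fun r r' => schwartzBruhat_translate_two_sided hΦ r⁻¹ r'
    rw [hf, gjLocalZeta_sum_left μ R (fun r X => ∑ r' ∈ R, Φ (((r⁻¹ : GL (Fin n) F) :
      Matrix (Fin n) (Fin n) F) * X * (r' : Matrix (Fin n) (Fin n) F))) _ s (fun r _ => ?_)]
    · rw [Finset.sum_congr rfl fun r hr => gjLocalZeta_sum_left μ R (fun r' X => Φ (((r⁻¹ : GL (Fin n) F) :
        Matrix (Fin n) (Fin n) F) * X * (r' : Matrix (Fin n) (Fin n) F))) _ s (fun r' _ => hint _ (hSB r r') s hs)]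
      rw [Finset.sum_congr rfl fun r hr => Finset.sum_congr rfl fun r' hr' => hterm r hr r' hr']
      simp only [Finset.sum_const, nsmul_eq_mul]
      ring
    · have e : (fun X => ∑ r' ∈ R, Φ (((r⁻¹ : GL (Fin n) F) : Matrix (Fin n) (Fin n) F) * X *
          (r' : Matrix (Fin n) (Fin n) F))) = ∑ r' ∈ R, fun X => Φ (((r⁻¹ : GL (Fin n) F) :
            Matrix (Fin n) (Fin n) F) * X * (r' : Matrix (Fin n) (Fin n) F)) := by
        funext X; simp only [Finset.sum_apply]
      rw [e]
      exact hint _ (Submodule.sum_mem _ fun r' _ => hSB r r') s hs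

end Averaging

/-! ### The main theorem -/

section Main

variable {F : Type} [Field F] [ValuativeRel F] [TopologicalSpace F] [IsNonarchimedeanLocalField F] {n : ℕ}

/-- **Godement–Jacquet (1972), Thm. 3.3 (2) — discharge of
`GodementJacquet1972_local_existsUnique_hasGJLFactor`.** For an irreducible admissible
representation `π` of `GL_n(F)` and a Haar measure, the local `L`-factor `L(s, π) = P(q^{-s})⁻¹`
(`P(0) = 1`) generating the fractional ideal of the zeta integrals exists and is unique. Proof: the
common-denominator criterion `GodementJacquet1972_local_existsUnique_hasGJLFactor_of_denominators`,
fed by the level-`K_m` rationality theorem `exists_poly_isLaurentTimes_classFun`, cyclicity of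
`v₀` and `φ₀` (`Representation.isIrreducible_contragredient_holds`), central scaling and finite
bi-`K_m`-averaging (`exists_classFun_gjLocalZeta_eq`); see the module docstring.
[cite: GodementJacquet1972, Thm. 3.3 (2)] -/
theorem GodementJacquet1972_local_existsUnique_hasGJLFactor_holds :
    GodementJacquet1972_local_existsUnique_hasGJLFactor (F := F) (n := n) := by
  refine GodementJacquet1972_local_existsUnique_hasGJLFactor_of_denominators ?_
  intro _ _ μG _ V _ _ ρ _ hρ
  classical
  haveI : T2Space F := t2Space_of_isNonarchimedeanLocalField
  haveI : NonarchimedeanGroup (GL (Fin n) F) := nonarchimedeanGroup_gl F n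
  haveI : LocallyCompactSpace (Matrix (Fin n) (Fin n) F) :=
    inferInstanceAs (LocallyCompactSpace (Fin n → Fin n → F))
  haveI : LocallyCompactSpace (GL (Fin n) F) := inferInstance
  haveI : μG.IsMulRightInvariant := isMulRightInvariant_of_isHaarMeasure_gl μG
  have hq1 : 1 < residueFieldCard F := one_lt_residueFieldCard F
  have hq0 : residueFieldCard F ≠ 0 := by omega
  -- a uniformizer with `|ϖ| = q⁻¹`
  obtain ⟨ϖu, hϖu'⟩ := Valuation.exists_isUniformizer_of_isCyclic_of_nontrivial (valuation F)
  have hϖq : normAbs F (ϖu : F) = ((residueFieldCard F : ℝ≥0))⁻¹ := normAbs_uniformizer_holds hϖu'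
  have hϖ : IsUniformizingElement (ϖu : F) := isUniformizingElement_of_normAbs_eq hϖq
  -- a non-zero vector `v₀`, its level `K_m`, and a `K_m`-fixed smooth form `φ₀` with `φ₀ v₀ ≠ 0`
  haveI : Nontrivial V := Representation.IsIrreducible.nontrivial ρ
  obtain ⟨v₀, hv₀0⟩ := exists_ne (0 : V)
  obtain ⟨m, hm, hsub⟩ := exists_congruenceGL_pow_subset hϖ
    ((hρ.1 v₀).mem_nhds ((ρ.stabilizerSubgroup v₀).one_mem))
  have hv₀ : v₀ ∈ ρ.fixedPoints (congruenceGL n (valuation F (ϖu : F) ^ m)) :=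
    (ρ.mem_fixedPoints _ v₀).2 fun g hg => hsub hg
  have hKo : IsOpen ((congruenceGL n (valuation F (ϖu : F) ^ m) : Subgroup (GL (Fin n) F)) : Set (GL (Fin n) F)) :=
    isOpen_congruenceGL (valuation_pow_ne_zero' hϖ.ne_zero m)
  have hKc : IsCompact ((congruenceGL n (valuation F (ϖu : F) ^ m) : Subgroup (GL (Fin n) F)) :
      Set (GL (Fin n) F)) := isCompact_congruenceGL _
  haveI : Module.Finite ℂ (ρ.fixedPoints (congruenceGL n (valuation F (ϖu : F) ^ m))) :=
    hρ.2 ⟨_, hKo⟩ hKc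
  obtain ⟨φ₀, hφ₀, hφ₀K, hφ₀v⟩ :=
    hρ.1.exists_mem_contragredient_apply_ne_zero_of_mem_fixedPoints hKo hKc hv₀ hv₀0
  -- the common abscissa of convergence
  obtain ⟨s₀, hs₀⟩ := GodementJacquet1972_local_convergence_holds (F := F) (n := n) μG ρ hρ
  -- the family of smooth linear forms
  set Ψ : Set (Module.Dual ℂ V) := {φ | φ ∈ ρ.contragredient} with hΨ
  have hΨG : ∀ φ ∈ Ψ, ∀ g : GL (Fin n) F, φ ∘ₗ ρ g ∈ Ψ := by
    intro φ hφ g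
    have h := ρ.contragredient.apply_mem_toSubmodule g⁻¹ hφ
    rw [Representation.dual_apply, inv_inv, Module.Dual.transpose_apply] at h
    exact h
  have hcomp : ∀ (φ : Module.Dual ℂ V) (g : GL (Fin n) F), ρ.dual g φ = φ ∘ₗ ρ g⁻¹ := by
    intro φ g; rw [Representation.dual_apply, Module.Dual.transpose_apply]
  have hint : ∀ Φ ∈ SchwartzBruhat (Matrix (Fin n) (Fin n) F), ∀ ψ ∈ Ψ, ∀ (u : V) (s : ℂ),
      s₀ < s.re → Integrable (gjLocalIntegrand Φ (ρ.matrixCoeff ψ u) s) μG :=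
    fun Φ hΦ ψ hψ u s hs => hs₀ Φ hΦ ψ hψ u s hs
  obtain ⟨P₀, hP₀0, hP₀⟩ := exists_poly_isLaurentTimes_classFun ρ μG hϖq hm Ψ
    (fun ψ hψ κ _ => hΨG ψ hψ κ) s₀ hint
  -- KEY: one vector `v₀`, all `K_m`-invariant smooth forms, all test functions
  have key : ∀ Φ ∈ SchwartzBruhat (Matrix (Fin n) (Fin n) F), ∀ φ ∈ Ψ,
      (∀ k ∈ congruenceGL n (valuation F (ϖu : F) ^ m), ∀ v, φ (ρ k v) = φ v) →
      IsLaurentTimes (residueFieldCard F) s₀ P₀ (fun s => gjLocalZeta μG Φ (ρ.matrixCoeff φ v₀) s) := by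
    intro Φ hΦ φ hφ hφK
    -- central scaling
    obtain ⟨r, hr⟩ := exists_isIntegralMatrix_smul_of_hasCompactSupport hϖ hΦ.2
    set c : GL (Fin n) F := zpowDiagGL hϖ.ne_zero (fun _ => -(r : ℤ)) with hc
    have hccoe : (c : Matrix (Fin n) (Fin n) F) = ((ϖu : F) ^ r)⁻¹ • (1 : Matrix (Fin n) (Fin n) F) := by
      rw [hc, coe_zpowDiagGL]
      ext i j
      rw [Matrix.diagonal_apply, Matrix.smul_apply, Matrix.one_apply, smul_eq_mul, _root_.zpow_neg, zpow_natCast]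
      split_ifs <;> simp
    set Φ₁ : Matrix (Fin n) (Fin n) F → ℂ := fun Y => Φ ((c : Matrix (Fin n) (Fin n) F) * Y) with hΦ₁
    have hΦ₁SB : Φ₁ ∈ SchwartzBruhat (Matrix (Fin n) (Fin n) F) := schwartzBruhat_comp_mul_left c hΦ
    have hΦ₁supp : ∀ Y, Φ₁ Y ≠ 0 → IsIntegralMatrix Y := by
      intro Y hY
      have h := hr _ hY
      rwa [hccoe, Matrix.smul_mul, Matrix.one_mul, smul_smul, mul_inv_cancel₀ (pow_ne_zero _ hϖ.ne_zero),
        one_smul] at h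
    have hΦeq : Φ = fun X => Φ₁ (((c⁻¹ : GL (Fin n) F) : Matrix (Fin n) (Fin n) F) * X *
        (((1 : GL (Fin n) F)⁻¹ : GL (Fin n) F) : Matrix (Fin n) (Fin n) F)) := by
      funext X
      simp only [hΦ₁]
      rw [inv_one, Units.val_one, Matrix.mul_one, ← Matrix.mul_assoc, ← Units.val_mul, mul_inv_cancel,
        Units.val_one, Matrix.one_mul]
    have hcentral : ∀ k : GL (Fin n) F, c * k = k * c := by
      intro k
      ext1
      rw [Units.val_mul, Units.val_mul, hccoe, Matrix.smul_mul, Matrix.mul_smul, Matrix.one_mul, Matrix.mul_one]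
    set φ₁ : Module.Dual ℂ V := φ ∘ₗ ρ c with hφ₁
    have hφ₁Ψ : φ₁ ∈ Ψ := hΨG φ hφ c
    have hφ₁K : ∀ k ∈ congruenceGL n (valuation F (ϖu : F) ^ m), ∀ v, φ₁ (ρ k v) = φ₁ v := by
      intro k hk v
      simp only [hφ₁, LinearMap.comp_apply]
      rw [← Module.End.mul_apply, ← map_mul, hcentral k, map_mul, Module.End.mul_apply, hφK k hk]
    obtain ⟨N, f, cst, hcst, hclass, hfsupp, hZf⟩ := exists_classFun_gjLocalZeta_eq ρ μG hϖ hΦ₁SB hΦ₁supp hv₀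
      hφ₁K (fun Φ' hΦ' s hs => hint Φ' hΦ' φ₁ hφ₁Ψ v₀ s hs)
    have hL1 : IsLaurentTimes (residueFieldCard F) s₀ P₀
        (fun s => gjLocalZeta μG Φ₁ (ρ.matrixCoeff φ₁ v₀) s) := by
      refine ((hP₀ N f hclass hfsupp v₀ hv₀ φ₁ hφ₁Ψ).const_mul cst⁻¹).congr fun s hs => ?_
      rw [hZf s hs, ← mul_assoc, inv_mul_cancel₀ hcst, one_mul]
    obtain ⟨e, he⟩ := exists_int_cpow_normAbs_eq (F := F)
      (y := ((Matrix.GeneralLinearGroup.det c : Fˣ) : F)) (Units.ne_zero _)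
    refine (hL1.qpow_zpow_mul e).congr fun s _ => ?_
    rw [hΦeq, gjLocalZeta_comp_conj_det ρ μG Φ₁ φ v₀ c 1 s, he s, map_one, map_one, Units.val_one, map_one,
      NNReal.coe_one, Complex.ofReal_one, Complex.one_cpow, mul_one, Module.End.one_apply]
  -- a general coefficient: cyclic decompositions of `v` and `φ`
  set σ : ℂ := ((n : ℂ) - 1) / 2 with hσ
  have hP₀ne : P₀ ≠ 0 := fun h => by rw [h, Polynomial.eval_zero] at hP₀0; exact zero_ne_one hP₀0
  refine ⟨P₀.comp (Polynomial.C ((residueFieldCard F : ℂ) ^ (-σ)) * X), fun Φ hΦ φ hφ v => ?_⟩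
  refine exists_isLaurent_eqOn_of_isLaurentTimes (s₀ := s₀) hq1 hP₀ne ?_ σ
  obtain ⟨cV, hcV⟩ := exists_finsupp_sum_smul_apply_eq ρ hv₀0 v
  have hirr : ρ.contragredientRep.IsIrreducible := Representation.isIrreducible_contragredient_holds ρ hρ
  have hΦ₀0 : (⟨φ₀, hφ₀⟩ : ρ.Contragredient) ≠ 0 := fun h => by
    have : φ₀ = 0 := congrArg (Representation.Contragredient.subtype ρ) h
    exact hφ₀v (by rw [this, LinearMap.zero_apply])
  obtain ⟨d, hd⟩ := exists_finsupp_sum_smul_apply_eq ρ.contragredientRep hΦ₀0 ⟨φ, hφ⟩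
  have hv : v = ∑ g ∈ cV.support, cV g • ρ g v₀ := by rw [← hcV]; rfl
  have hφ' : φ = ∑ h ∈ d.support, d h • ρ.dual h φ₀ := by
    have := congrArg (Representation.Contragredient.subtype ρ) hd
    rw [Finsupp.sum, map_sum] at this
    rw [← show Representation.Contragredient.subtype ρ ⟨φ, hφ⟩ = φ from rfl, ← this]
    refine Finset.sum_congr rfl fun h _ => ?_
    rw [map_smul, Representation.subtype_contragredientRep_apply]
    rfl
  -- the coefficient as a combination of twisted coefficients of `(v₀, φ₀)`
  have hcoeff : ρ.matrixCoeff φ v = fun x => ∑ p ∈ d.support ×ˢ cV.support,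
      (d p.1 * cV p.2) * ρ.matrixCoeff (φ₀ ∘ₗ ρ p.1⁻¹) (ρ p.2 v₀) x := by
    funext x
    rw [Finset.sum_product, Representation.matrixCoeff_apply, hv, hφ', LinearMap.sum_apply]
    refine Finset.sum_congr rfl fun h _ => ?_
    rw [LinearMap.smul_apply, map_sum, map_sum, smul_eq_mul, Finset.mul_sum]
    refine Finset.sum_congr rfl fun g _ => ?_
    rw [map_smul, map_smul, smul_eq_mul, hcomp, Representation.matrixCoeff_apply]
    simp only [LinearMap.comp_apply]
    ring
  have hφ₀K' : ∀ k ∈ congruenceGL n (valuation F (ϖu : F) ^ m), ∀ v, φ₀ (ρ k v) = φ₀ v := by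
    intro k hk w
    have h := hφ₀K k⁻¹ (Subgroup.inv_mem _ hk)
    rw [hcomp, inv_inv] at h
    exact congrArg (fun ψ : Module.Dual ℂ V => ψ w) h
  -- each twisted coefficient
  have hterm : ∀ (h g : GL (Fin n) F), IsLaurentTimes (residueFieldCard F) s₀ P₀
      (fun s => gjLocalZeta μG Φ (ρ.matrixCoeff (φ₀ ∘ₗ ρ h⁻¹) (ρ g v₀)) s) := by
    intro h g
    set Φ' : Matrix (Fin n) (Fin n) F → ℂ := fun X => Φ ((((h⁻¹)⁻¹ : GL (Fin n) F) : Matrix (Fin n) (Fin n) F) *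
      X * ((g⁻¹ : GL (Fin n) F) : Matrix (Fin n) (Fin n) F)) with hΦ'
    have hΦ'SB : Φ' ∈ SchwartzBruhat (Matrix (Fin n) (Fin n) F) := schwartzBruhat_translate_two_sided hΦ _ _
    have hL := key Φ' hΦ'SB φ₀ hφ₀ hφ₀K'
    obtain ⟨e₁, he₁⟩ := exists_int_cpow_normAbs_eq (F := F)
      (y := ((Matrix.GeneralLinearGroup.det h⁻¹ : Fˣ) : F)) (Units.ne_zero _)
    obtain ⟨e₂, he₂⟩ := exists_int_cpow_normAbs_eq (F := F)
      (y := ((Matrix.GeneralLinearGroup.det g : Fˣ) : F)) (Units.ne_zero _)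
    have hid := fun s => gjLocalZeta_comp_conj_det ρ μG Φ φ₀ v₀ h⁻¹ g s
    refine (hL.qpow_zpow_mul (-(e₁ + e₂))).congr fun s _ => ?_
    have hx : (residueFieldCard F : ℂ) ^ (-s) ≠ 0 := qpow_ne_zero hq0 s
    have h1 := hid s
    rw [he₁ s, he₂ s] at h1
    -- `x^{e₁} x^{e₂} T = Z(Φ')`
    have h2 : gjLocalZeta μG Φ (ρ.matrixCoeff (φ₀ ∘ₗ ρ h⁻¹) (ρ g v₀)) s =
        (((residueFieldCard F : ℂ) ^ (-s)) ^ e₁ * ((residueFieldCard F : ℂ) ^ (-s)) ^ e₂)⁻¹ *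
          gjLocalZeta μG Φ' (ρ.matrixCoeff φ₀ v₀) s := by
      have hA : ((residueFieldCard F : ℂ) ^ (-s)) ^ e₁ ≠ 0 := zpow_ne_zero _ hx
      have hB : ((residueFieldCard F : ℂ) ^ (-s)) ^ e₂ ≠ 0 := zpow_ne_zero _ hx
      rw [hΦ', h1]
      field_simp
    rw [h2, ← zpow_add₀ hx, ← _root_.zpow_neg]
  -- assemble
  refine (IsLaurentTimes.sum hq0 (d.support ×ˢ cV.support) (fun p _ => (hterm p.1 p.2).const_mul (d p.1 * cV p.2))).congr
    fun s hs => ?_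
  rw [hcoeff, gjLocalZeta_sum_right μG _ Φ _ _ s (fun p _ => hint Φ hΦ _ (hΨG φ₀ hφ₀ _) _ s hs)]

end Main

end Literature.NumberTheory.Automorphic
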